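import Literature.MathematicalPhysics.QuantumLattice.GroundStateReflectionPositivity
import Literature.MathematicalPhysics.QuantumLattice.KroneckerTraceSchwarz
import Literature.MathematicalPhysics.QuantumLattice.ApproximatingHamiltonianProofs
import Literature.MathematicalPhysics.QuantumLattice.FinDimSpectrumProofs
import HarnessLib

/-!
# Lieb–Schupp: the canonical singlet, the field inequality `E_b ≥ E_0` and the ice rule for
# reflection-symmetric Kronecker Hamiltonians (abstract form)

Topic `MathematicalPhysics/QuantumLattice`; companion of `GroundStateReflectionPositivity.lean`
(`Matrix.exists_posSemidef_groundState`: a reflection-symmetric Kronecker Hamiltonian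
`K = A ⊗ 1 + 1 ⊗ A - Σᵢ Mᵢ ⊗ Mᵢ`, `Aᵀ = A`, `Mᵢ` real, has a ground state `vec c` with `c ⪰ 0` —
Kennedy–Lieb–Shastry 1988 eqs. (23)–(25) = Lieb–Schupp 2000 §3–§4) and of
`XYOrderGDProofs.lean` (`Matrix.kls_groundEnergy_reflection`, `Matrix.exists_kls_tracePair`).
This file adds, at the same ABSTRACT level (square matrices `c` ↔ vectors
`vec c = fun p : m × m => c p.1 p.2` of the doubled system; left factor = left half, right
factor = the right half after the spin rotation by `π` about the `2`-axis), the remaining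
statements of

* E. H. Lieb, P. Schupp, *Ground state properties of a fully frustrated quantum spin system*,
  Phys. Rev. Lett. **83** (1999) 5362–5365 [LiebSchupp1999] (held: `paper:arxiv-math-ph_9908019`);
* E. H. Lieb, P. Schupp, *Singlets and reflection symmetric spin systems*, Physica A **279**
  (2000) 378–385 [LiebSchupp2000] (held: `paper:arxiv-math-ph_9910037`),

namely (locators refer to the arXiv versions):

* `Matrix.star_uncurry_one_dotProduct_uncurry` — **[LiebSchupp2000] §5** "The overlap of any
  state with coefficient matrix `c` with the canonical state `Ξ` [coefficient matrix `1`] is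
  simply the trace of `c`": `⟨vec 1, vec c⟩ = tr c`; with `Matrix.exists_posSemidef_groundState`
  this gives `Matrix.liebSchupp_exists_posSemidef_groundState_trace_pos` — a ground state
  `vec c`, `c ⪰ 0`, `tr c > 0`, `⟨vec 1, vec c⟩ ≠ 0` ("there is always a ground state that contains
  a spin-zero part").
* `Matrix.kroneckerSum_mulVec_uncurry_one_eq_zero` — the canonical state is annihilated by every
  "charge" `X ⊗ 1 + 1 ⊗ Y` with `Yᵀ = -X` (§5: "`Ξ` has total spin zero because of the spin
  rotation in the right subsystem"; in the application `X = Σ_x S^α_x` on the left half and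
  `Y = ±X` is its rotated copy).
* `Matrix.exists_groundState_forall_mulVec_eq_zero` — the abstract form of the conclusion of §5:
  if operators `Q_j` commute with a Hermitian `K` and annihilate a vector `ξ` having non-zero
  overlap with SOME ground state, then `P₀ ξ` (`P₀` = ground-state projection) is a non-zero
  ground state annihilated by every `Q_j` ("Provided that total spin is a good quantum number, we
  can conclude further that our system always has a ground state with total spin zero");
  packaged for Kronecker charges as `Matrix.liebSchupp_exists_groundState_annihilated`.
* `Matrix.liebSchupp_groundEnergy_sub_field_ge` — **[LiebSchupp2000] §7 / [LiebSchupp1999] p. 3,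
  the field inequality `E_b ≥ E_0`**: for one crossing operator `M = M_{i₀}` which is real AND
  symmetric, `E₀(K - b(M ⊗ 1 - 1 ⊗ M)) ≥ E₀(K) - b²/2` for every real `b` (printed:
  `H(b) ≡ H - b(S³_B + S³_{B'}) + b²/2`, `E_b ≥ E_0`; "The trace inequality effectively removes the
  parameter `b` from the Hamiltonian" — here literally `Matrix.kls_groundEnergy_reflection` applied
  to `A ∓ (b/2)M`, `M ∓ b/2`, whose doubled Hamiltonians are both `K - b²/4`,
  `Matrix.liebSchupp_kroneckerForm_update_eq`). [LiebSchupp1999] p. 4 reads it, "assuming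
  differentiability", as the bound `χ ≤ 1/4` on the zero-field susceptibility of the crossing unit;
  the energy inequality is the rigorous content and is what is proved here.
* `Matrix.liebSchupp_iceRule` — **§7, eq. (ice)**: for EVERY ground-state vector `ψ` of `K` (no
  uniqueness and no symmetry of the coefficient matrix assumed), `⟨ψ, (M ⊗ 1 - 1 ⊗ M) ψ⟩ = 0`
  ("variational argument: `⟨ψ₀|H(b)|ψ₀⟩ ≥ E_b ≥ E_0 = ⟨ψ₀|H|ψ₀⟩`, or
  `⟨ψ₀| b(S³_B + S³_{B'}) |ψ₀⟩ ≤ b²/2`, which implies (ice)").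
* `Matrix.liebSchupp_partitionFn_sub_field_le` — **[LiebSchupp1999] p. 4**, "All these results
  continue to hold at finite temperature … `Z_b ≤ Z_0`, as can be shown by a straightforward
  application of lemma 4.1 in section 4 of [DLS]": `Z_β(K - b(M ⊗ 1 - 1 ⊗ M)) ≤ e^{βb²/2} Z_β(K)`
  (`β ≥ 0`, `A` real; DLS Lemma 4.1 is the tree's `Matrix.trace_exp_kroneckerSum_le`), i.e. the
  free energy satisfies `F(b) + b²/2 ≥ F(0)`: zero magnetisation of the crossing unit and the same
  susceptibility bound at every temperature.
* `Matrix.mulVec_eq_zero_of_forall_groundSpace` — the mechanism of [LiebSchupp1999] p. 3,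
  "Since `S³_tot` is a good quantum number and `S^±_tot` commute with the hamiltonian, this will
  imply that all ground states in such a system have total spin zero": a Hermitian `D` commuting
  with `K` whose expectation vanishes in EVERY ground state annihilates the ground space
  (polarisation with `ψ + Dψ`).

Everything is proved (no named facts, no definitions). The lattice models (reflection-symmetric
Heisenberg models with positive-semidefinite antiferromagnetic crossing couplings — the
pyrochlore checkerboard of [LiebSchupp1999], the `J₁–J₂` square lattice with `|J₂| ≤ J₁/2` — and
their right-half spin rotation) are the business of a companion file; §6 of [LiebSchupp2000]
(the projection onto spin zero preserves positive semidefiniteness of the coefficient matrix,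
"only of academic interest here" [LiebSchupp1999] p. 3) is not formalised.

Conventions (those of `Matrix.kls_groundEnergy_reflection`): `A` complex symmetric (`Aᵀ = A`;
in the thermal statement real, `Aᵀ = Aᴴ`), the crossing operators `Mᵢ` real (`Mᵢᵀ = Mᵢᴴ`), the
distinguished one `M_{i₀}` moreover symmetric (`M_{i₀}ᵀ = M_{i₀}`, e.g. `Σ_{x∈B} j_x S³_x` or
`Σ j_x S¹_x` in the `S³`-basis); `K` Hermitian.

## References
* [LiebSchupp1999] E. H. Lieb, P. Schupp, Phys. Rev. Lett. 83 (1999) 5362, pp. 2–4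
  (arXiv:math-ph/9908019).
* [LiebSchupp2000] E. H. Lieb, P. Schupp, Physica A 279 (2000) 378, §§3–5, §7
  (arXiv:math-ph/9910037).
* [KLS1988JSP] T. Kennedy, E. H. Lieb, B. S. Shastry, J. Stat. Phys. 53 (1988) 1019, eqs. (20)–(25).
* [DLS1978] F. J. Dyson, E. H. Lieb, B. Simon, J. Stat. Phys. 18 (1978) 335, Lemma 4.1.
-/

noncomputable section

open Matrix Finset
open scoped ComplexOrder Kronecker

namespace Matrix

open Literature.MathematicalPhysics.QuantumLattice

/-! ### The canonical state `vec 1`: overlap and charges ([LiebSchupp2000] §5) -/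

section Canonical

variable {m : Type*} [Fintype m] [DecidableEq m]

/-- `(X ⊗ 1 + 1 ⊗ Y) vec c = vec (X c + c Yᵀ)` — the action of `H_L + H_R = h ⊗ 1 + 1 ⊗ h̃`
on a state with coefficient matrix `c` ([LiebSchupp2000] §2, the eigenvalue equation
`h_L c + c (h_R)ᵀ - … = E c` of [LiebSchupp1999] eq. (ev); [KLS1988JSP] eq. (22)).
[cite: LiebSchupp1999, eq. (ev)] [cite: KLS1988JSP, eq. (22)] -/
theorem kroneckerSum_mulVec_uncurry (X Y c : Matrix m m ℂ) :
    (X ⊗ₖ (1 : Matrix m m ℂ) + (1 : Matrix m m ℂ) ⊗ₖ Y) *ᵥ (fun p : m × m => c p.1 p.2) =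
      fun p : m × m => (X * c + c * Yᵀ) p.1 p.2 := by
  rw [add_mulVec, kronecker_mulVec_uncurry, kronecker_mulVec_uncurry, transpose_one, Matrix.mul_one,
    Matrix.one_mul]
  funext p
  simp only [Pi.add_apply, add_apply]

/-- **The canonical state is annihilated by the rotated charges** ([LiebSchupp2000] §5: "The state
`Ξ` has total spin zero because of the spin rotation in the right subsystem"): if `Yᵀ = -X` then
`(X ⊗ 1 + 1 ⊗ Y) vec 1 = 0`. [cite: LiebSchupp2000, §5] -/
theorem kroneckerSum_mulVec_uncurry_one_eq_zero {X Y : Matrix m m ℂ} (h : Yᵀ = -X) :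
    (X ⊗ₖ (1 : Matrix m m ℂ) + (1 : Matrix m m ℂ) ⊗ₖ Y) *ᵥ
        (fun p : m × m => (1 : Matrix m m ℂ) p.1 p.2) = 0 := by
  rw [kroneckerSum_mulVec_uncurry, Matrix.mul_one, Matrix.one_mul, h, add_neg_cancel]
  funext p
  rfl

/-- **Overlap with the canonical state is the trace** ([LiebSchupp2000] §5: "The overlap of any
state with coefficient matrix `c` with the canonical state `Ξ` is simply the trace of `c`").
[cite: LiebSchupp2000, §5] -/
theorem star_uncurry_one_dotProduct_uncurry (c : Matrix m m ℂ) :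
    star (fun p : m × m => (1 : Matrix m m ℂ) p.1 p.2) ⬝ᵥ (fun p : m × m => c p.1 p.2) = trace c := by
  rw [star_uncurry_dotProduct_uncurry, conjTranspose_one, Matrix.one_mul]

/-- **A positive ground state overlaps the canonical state** ([LiebSchupp2000] §§4–5;
[LiebSchupp1999] p. 3): a reflection-symmetric Kronecker Hamiltonian
`K = A ⊗ 1 + 1 ⊗ A - Σᵢ Mᵢ ⊗ Mᵢ` (`Aᵀ = A`, `Mᵢ` real, `K` Hermitian) has a unit ground-state vector
`vec c` with `c ⪰ 0`, `0 < tr c`, hence `⟨vec 1, vec c⟩ ≠ 0` ("which, by definition, has a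
(non-zero) positive trace"). The positive ground state itself is the tree's
`Matrix.exists_posSemidef_groundState`. [cite: LiebSchupp2000, §§4–5] -/
theorem liebSchupp_exists_posSemidef_groundState_trace_pos [Nonempty m] {ι : Type*} [Fintype ι]
    (A : Matrix m m ℂ) (M : ι → Matrix m m ℂ) (hA : Aᵀ = A) (hMt : ∀ i, (M i)ᵀ = (M i)ᴴ)
    (hK : (A ⊗ₖ (1 : Matrix m m ℂ) + (1 : Matrix m m ℂ) ⊗ₖ A - ∑ i, M i ⊗ₖ M i).IsHermitian) :
    ∃ c : Matrix m m ℂ, c.PosSemidef ∧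
      star (fun p : m × m => c p.1 p.2) ⬝ᵥ (fun p : m × m => c p.1 p.2) = 1 ∧
      (fun p : m × m => c p.1 p.2) ∈
        (A ⊗ₖ (1 : Matrix m m ℂ) + (1 : Matrix m m ℂ) ⊗ₖ A - ∑ i, M i ⊗ₖ M i).groundSpace ∧
      0 < trace c ∧
      star (fun p : m × m => (1 : Matrix m m ℂ) p.1 p.2) ⬝ᵥ (fun p : m × m => c p.1 p.2) ≠ 0 := by
  obtain ⟨c, hc, hc1, hmem⟩ := exists_posSemidef_groundState A M hA hMt hK
  have hc0 : c ≠ 0 := by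
    intro h0
    rw [h0] at hc1
    simp at hc1
  have htr : 0 < trace c :=
    lt_of_le_of_ne hc.trace_nonneg fun h => hc0 (hc.trace_eq_zero_iff.1 h.symm)
  refine ⟨c, hc, hc1, hmem, htr, ?_⟩
  rw [star_uncurry_one_dotProduct_uncurry]
  exact htr.ne'

end Canonical

/-! ### Ground states annihilated by commuting charges ([LiebSchupp2000] §5, [LiebSchupp1999] p. 3) -/

section Charges

variable {N : Type*} [Fintype N] [DecidableEq N]

/-- **Projection of a symmetric vector onto the ground space** ([LiebSchupp2000] §5, abstract
form): let `K` be Hermitian, let the operators `Q_j` commute with `K` and annihilate `ξ`, and let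
some ground-state vector `ψ` have `⟨ψ, ξ⟩ ≠ 0`. Then `φ = P₀ ξ` is a ground-state vector with
`⟨ψ, φ⟩ = ⟨ψ, ξ⟩ ≠ 0` (so `φ ≠ 0`) annihilated by every `Q_j` (`P₀` commutes with the `Q_j`,
`Matrix.groundProj_commute_of_commute`). [cite: LiebSchupp2000, §5] -/
theorem exists_groundState_forall_mulVec_eq_zero {K : Matrix N N ℂ} (hK : K.IsHermitian)
    {ι : Type*} (Q : ι → Matrix N N ℂ) (hQ : ∀ j, Q j * K = K * Q j) {ξ : N → ℂ}
    (hξ : ∀ j, Q j *ᵥ ξ = 0) {ψ : N → ℂ} (hψ : ψ ∈ K.groundSpace) (hψξ : star ψ ⬝ᵥ ξ ≠ 0) :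
    ∃ φ ∈ K.groundSpace, star ψ ⬝ᵥ φ = star ψ ⬝ᵥ ξ ∧ φ ≠ 0 ∧ ∀ j, Q j *ᵥ φ = 0 := by
  have hrow : star ψ ᵥ* K.groundProj = star ψ := by
    rw [← conjTranspose_conjTranspose K.groundProj, ← star_mulVec, (groundProj_isHermitian K).eq,
      groundProj_mulVec_of_mem K hψ]
  refine ⟨K.groundProj *ᵥ ξ, groundProj_mulVec_mem K ξ, ?_, ?_, fun j => ?_⟩
  · rw [dotProduct_mulVec, hrow]
  · intro h0
    apply hψξ
    rw [← hrow, ← dotProduct_mulVec, h0, dotProduct_zero]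
  · rw [mulVec_mulVec, ← groundProj_commute_of_commute hK (hQ j), ← mulVec_mulVec, hξ, mulVec_zero]

/-- **An operator with vanishing expectation in every ground state annihilates the ground space**
([LiebSchupp1999] p. 3: "Since `S³_tot` is a good quantum number and `S^±_tot` commute with the
hamiltonian, this will imply that all ground states in such a system have total spin zero"): for
`D` Hermitian commuting with `K`, if `⟨ψ, Dψ⟩ = 0` for all `ψ` in the ground space then `Dψ = 0`
there (polarise with `ψ + Dψ`, which is again a ground-state vector). [cite: LiebSchupp1999, p. 3] -/
theorem mulVec_eq_zero_of_forall_groundSpace {K D : Matrix N N ℂ} (hD : D.IsHermitian)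
    (hDK : D * K = K * D) (h : ∀ ψ ∈ K.groundSpace, star ψ ⬝ᵥ (D *ᵥ ψ) = 0) :
    ∀ ψ ∈ K.groundSpace, D *ᵥ ψ = 0 := by
  intro ψ hψ
  have hφmem : D *ᵥ ψ ∈ K.groundSpace := mulVec_mem_groundSpace_of_commute hDK hψ
  have hsum := h (ψ + D *ᵥ ψ) (K.groundSpace.add_mem hψ hφmem)
  have h1 := h ψ hψ
  have h2 := h (D *ᵥ ψ) hφmem
  -- `⟨ψ, D(Dψ)⟩ = ⟨Dψ, Dψ⟩`
  have hrow : star ψ ᵥ* D = star (D *ᵥ ψ) := by rw [star_mulVec, hD.eq]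
  have hcross : star ψ ⬝ᵥ (D *ᵥ (D *ᵥ ψ)) = star (D *ᵥ ψ) ⬝ᵥ (D *ᵥ ψ) := by
    rw [dotProduct_mulVec, hrow]
  rw [mulVec_add, star_add, add_dotProduct, dotProduct_add, dotProduct_add, h1, h2, hcross, zero_add,
    add_zero, ← two_mul, mul_eq_zero] at hsum
  rcases hsum with h2' | h0
  · norm_num at h2'
  · exact dotProduct_star_self_eq_zero.1 h0

end Charges

/-! ### The field inequality `E_b ≥ E_0` and the ice rule ([LiebSchupp2000] §7) -/

section Field

variable {m : Type*} [Fintype m] [DecidableEq m]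

/-- `E₀(A + c·1) = E₀(A) + c` for Hermitian `A` and real `c`. [folklore] -/
private theorem liebSchupp_groundEnergy_add_real_smul_one [Nonempty m] {A : Matrix m m ℂ}
    (hA : A.IsHermitian) (c : ℝ) :
    (A + (c : ℂ) • (1 : Matrix m m ℂ)).groundEnergy = A.groundEnergy + c := by
  have hcA : (A + (c : ℂ) • (1 : Matrix m m ℂ)).IsHermitian := hA.add (isHermitian_one.ofReal_smul c)
  have hray : ∀ {ψ : m → ℂ}, star ψ ⬝ᵥ ψ = 1 →
      (star ψ ⬝ᵥ ((A + (c : ℂ) • (1 : Matrix m m ℂ)) *ᵥ ψ)).re = (star ψ ⬝ᵥ (A *ᵥ ψ)).re + c := by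
    intro ψ hψ
    rw [add_mulVec, smul_mulVec, one_mulVec, dotProduct_add, dotProduct_smul, hψ, smul_eq_mul, mul_one,
      Complex.add_re, Complex.ofReal_re]
  refine le_antisymm ?_ ?_
  · obtain ⟨ψ, hψ1, hψE⟩ := exists_groundState_unit hA
    have h := groundEnergy_le_rayleigh_holds hcA ψ hψ1
    rw [hray hψ1, hψE] at h
    exact h
  · obtain ⟨ψ, hψ1, hψE⟩ := exists_groundState_unit hcA
    have h := groundEnergy_le_rayleigh_holds hA ψ hψ1
    rw [hray hψ1] at hψE
    linarith

omit [Fintype m] in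
/-- `(r • 1)ᵀ = (r • 1)ᴴ` for real `r` (complex matrices). [folklore] -/
private theorem liebSchupp_transpose_real_smul_one (r : ℝ) :
    ((r : ℂ) • (1 : Matrix m m ℂ))ᵀ = ((r : ℂ) • (1 : Matrix m m ℂ))ᴴ := by
  rw [transpose_smul, transpose_one, conjTranspose_smul, conjTranspose_one, Complex.star_def,
    Complex.conj_ofReal]

omit [Fintype m] in
/-- **The field identity** behind `E_b ≥ E_0` ([LiebSchupp2000] §7, "Sketch of the proof":
`H(b) = H_L(b) + H_R(b) + H_C(b) + b²/4` with `H_{L,R}(b) = H_{L,R} ∓ (b/2)S³` and the crossing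
term `S³_B S³_{B'}` replaced by `(S³_B - b/2)(S³_{B'} - b/2)`): for scalars `s`, `t` and the
distinguished index `i₀`,
`(A + sM) ⊗ 1 + 1 ⊗ (A + tM) - [(M + s) ⊗ (M + t) + Σ_{i ≠ i₀} Mᵢ ⊗ Mᵢ]
   = K + (s - t)(M ⊗ 1 - 1 ⊗ M) - st·1`, `M = M_{i₀}`.
[cite: LiebSchupp2000, §7] -/
theorem liebSchupp_kroneckerForm_update_eq {ι : Type*} [Fintype ι] [DecidableEq ι]
    (A : Matrix m m ℂ) (M : ι → Matrix m m ℂ) (i₀ : ι) (s t : ℂ) :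
    (A + s • M i₀) ⊗ₖ (1 : Matrix m m ℂ) + (1 : Matrix m m ℂ) ⊗ₖ (A + t • M i₀) -
        ∑ i, Function.update M i₀ (M i₀ + s • (1 : Matrix m m ℂ)) i ⊗ₖ
          Function.update M i₀ (M i₀ + t • (1 : Matrix m m ℂ)) i =
      (A ⊗ₖ (1 : Matrix m m ℂ) + (1 : Matrix m m ℂ) ⊗ₖ A - ∑ i, M i ⊗ₖ M i) +
        (s - t) • (M i₀ ⊗ₖ (1 : Matrix m m ℂ) - (1 : Matrix m m ℂ) ⊗ₖ M i₀) -
        (s * t) • (1 : Matrix (m × m) (m × m) ℂ) := by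
  -- split off the distinguished summand on both sides
  have hsplit : ∀ (P Q : ι → Matrix m m ℂ),
      ∑ i, P i ⊗ₖ Q i = P i₀ ⊗ₖ Q i₀ + ∑ i ∈ univ.erase i₀, P i ⊗ₖ Q i := fun P Q =>
    (add_sum_erase univ (fun i => P i ⊗ₖ Q i) (mem_univ i₀)).symm
  rw [hsplit, hsplit M M, Function.update_self, Function.update_self]
  have hrest : ∑ i ∈ univ.erase i₀, Function.update M i₀ (M i₀ + s • (1 : Matrix m m ℂ)) i ⊗ₖ
      Function.update M i₀ (M i₀ + t • (1 : Matrix m m ℂ)) i = ∑ i ∈ univ.erase i₀, M i ⊗ₖ M i := by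
    refine sum_congr rfl fun i hi => ?_
    rw [Function.update_of_ne (ne_of_mem_erase hi), Function.update_of_ne (ne_of_mem_erase hi)]
  rw [hrest]
  simp only [add_kronecker, kronecker_add, smul_kronecker, kronecker_smul, one_kronecker_one]
  module

omit [Fintype m] in
/-- Hermiticity of the field operator `M ⊗ 1 - 1 ⊗ M` (the rotated `S³_B + S³_{B'}` of
[LiebSchupp2000] §7) for a real symmetric `M`. [cite: LiebSchupp2000, §7] -/
theorem liebSchupp_field_isHermitian {M : Matrix m m ℂ} (hMt : Mᵀ = Mᴴ) (hMs : Mᵀ = M) :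
    (M ⊗ₖ (1 : Matrix m m ℂ) - (1 : Matrix m m ℂ) ⊗ₖ M).IsHermitian := by
  have hM : Mᴴ = M := by rw [← hMt, hMs]
  rw [IsHermitian, conjTranspose_sub, conjTranspose_kronecker, conjTranspose_kronecker, conjTranspose_one,
    hM]

omit [Fintype m] in
/-- The shifted crossing operators `M_{i₀} + r` are still real. [folklore] -/
private theorem liebSchupp_update_transpose_eq {ι : Type*} [DecidableEq ι] {M : ι → Matrix m m ℂ}
    (hMt : ∀ i, (M i)ᵀ = (M i)ᴴ) (i₀ : ι) (r : ℝ) (i : ι) :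
    (Function.update M i₀ (M i₀ + (r : ℂ) • (1 : Matrix m m ℂ)) i)ᵀ =
      (Function.update M i₀ (M i₀ + (r : ℂ) • (1 : Matrix m m ℂ)) i)ᴴ := by
  by_cases hi : i = i₀
  · rw [hi, Function.update_self, transpose_add, conjTranspose_add, hMt,
      liebSchupp_transpose_real_smul_one]
  · rw [Function.update_of_ne hi]; exact hMt i

/-- **The field inequality `E_b ≥ E_0`** ([LiebSchupp2000] §7; [LiebSchupp1999] p. 3): for the
reflection-symmetric Kronecker Hamiltonian `K = A ⊗ 1 + 1 ⊗ A - Σᵢ Mᵢ ⊗ Mᵢ` (`Aᵀ = A`, `Mᵢ` real,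
`K` Hermitian) and a distinguished crossing operator `M = M_{i₀}` which is moreover symmetric,
`E₀(K) - b²/2 ≤ E₀(K - b(M ⊗ 1 - 1 ⊗ M))` for every real `b` — printed as `E_b ≥ E_0` for
`H(b) = H - b(S³_B + S³_{B'}) + b²/2`. Proof as printed: the ground-state reflection inequality
(`Matrix.kls_groundEnergy_reflection`) for the data `A ∓ (b/2)M`, `M ∓ b/2`
(`liebSchupp_kroneckerForm_update_eq`) "removes the parameter `b` from the Hamiltonian": both
doubled Hamiltonians are `K - b²/4`. [cite: LiebSchupp2000, §7] [cite: LiebSchupp1999, p. 3] -/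
theorem liebSchupp_groundEnergy_sub_field_ge [Nonempty m] {ι : Type*} [Fintype ι] [DecidableEq ι]
    (A : Matrix m m ℂ) (M : ι → Matrix m m ℂ) (hA : Aᵀ = A) (hMt : ∀ i, (M i)ᵀ = (M i)ᴴ)
    (i₀ : ι) (hMs : (M i₀)ᵀ = M i₀)
    (hK : (A ⊗ₖ (1 : Matrix m m ℂ) + (1 : Matrix m m ℂ) ⊗ₖ A - ∑ i, M i ⊗ₖ M i).IsHermitian)
    (b : ℝ) :
    (A ⊗ₖ (1 : Matrix m m ℂ) + (1 : Matrix m m ℂ) ⊗ₖ A - ∑ i, M i ⊗ₖ M i).groundEnergy - b ^ 2 / 2 ≤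
      ((A ⊗ₖ (1 : Matrix m m ℂ) + (1 : Matrix m m ℂ) ⊗ₖ A - ∑ i, M i ⊗ₖ M i) -
        (b : ℂ) • (M i₀ ⊗ₖ (1 : Matrix m m ℂ) - (1 : Matrix m m ℂ) ⊗ₖ M i₀)).groundEnergy := by
  set K := A ⊗ₖ (1 : Matrix m m ℂ) + (1 : Matrix m m ℂ) ⊗ₖ A - ∑ i, M i ⊗ₖ M i with hKdef
  set D := M i₀ ⊗ₖ (1 : Matrix m m ℂ) - (1 : Matrix m m ℂ) ⊗ₖ M i₀ with hDdef
  set σ : ℝ := b / 2 with hσ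
  -- the shifted data
  set Am : Matrix m m ℂ := A + ((-σ : ℝ) : ℂ) • M i₀ with hAm
  set Ap : Matrix m m ℂ := A + (σ : ℂ) • M i₀ with hAp
  set Mm : ι → Matrix m m ℂ := Function.update M i₀ (M i₀ + ((-σ : ℝ) : ℂ) • (1 : Matrix m m ℂ))
    with hMm
  set Mp : ι → Matrix m m ℂ := Function.update M i₀ (M i₀ + (σ : ℂ) • (1 : Matrix m m ℂ)) with hMp
  have hD : D.IsHermitian := liebSchupp_field_isHermitian (hMt i₀) hMs
  -- the three Kronecker forms
  have hKb : Am ⊗ₖ (1 : Matrix m m ℂ) + (1 : Matrix m m ℂ) ⊗ₖ Ap - ∑ i, Mm i ⊗ₖ Mp i =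
      (K - (b : ℂ) • D) + ((σ ^ 2 : ℝ) : ℂ) • (1 : Matrix (m × m) (m × m) ℂ) := by
    rw [hAm, hAp, hMm, hMp, liebSchupp_kroneckerForm_update_eq, ← hKdef, ← hDdef]
    have h1 : ((-σ : ℝ) : ℂ) - (σ : ℂ) = -(b : ℂ) := by
      rw [hσ]; push_cast; ring
    have h2 : ((-σ : ℝ) : ℂ) * (σ : ℂ) = -((σ ^ 2 : ℝ) : ℂ) := by push_cast; ring
    rw [h1, h2, neg_smul, neg_smul, sub_neg_eq_add, ← sub_eq_add_neg]
  have hKL : Am ⊗ₖ (1 : Matrix m m ℂ) + (1 : Matrix m m ℂ) ⊗ₖ Am - ∑ i, Mm i ⊗ₖ Mm i =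
      K + ((-(σ ^ 2) : ℝ) : ℂ) • (1 : Matrix (m × m) (m × m) ℂ) := by
    rw [hAm, hMm, liebSchupp_kroneckerForm_update_eq, ← hKdef, sub_self, zero_smul, add_zero]
    have h2 : ((-σ : ℝ) : ℂ) * ((-σ : ℝ) : ℂ) = -((-(σ ^ 2) : ℝ) : ℂ) := by push_cast; ring
    rw [h2, neg_smul, sub_neg_eq_add]
  have hKR : Ap ⊗ₖ (1 : Matrix m m ℂ) + (1 : Matrix m m ℂ) ⊗ₖ Ap - ∑ i, Mp i ⊗ₖ Mp i =
      K + ((-(σ ^ 2) : ℝ) : ℂ) • (1 : Matrix (m × m) (m × m) ℂ) := by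
    rw [hAp, hMp, liebSchupp_kroneckerForm_update_eq, ← hKdef, sub_self, zero_smul, add_zero]
    have h2 : (σ : ℂ) * (σ : ℂ) = -((-(σ ^ 2) : ℝ) : ℂ) := by push_cast; ring
    rw [h2, neg_smul, sub_neg_eq_add]
  -- hypotheses of the reflection inequality
  have hAm_t : Amᵀ = Am := by rw [hAm, transpose_add, transpose_smul, hMs, hA]
  have hAp_t : Apᵀ = Ap := by rw [hAp, transpose_add, transpose_smul, hMs, hA]
  have hMm_t : ∀ i, (Mm i)ᵀ = (Mm i)ᴴ := fun i => liebSchupp_update_transpose_eq hMt i₀ (-σ) i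
  have hMp_t : ∀ i, (Mp i)ᵀ = (Mp i)ᴴ := fun i => liebSchupp_update_transpose_eq hMt i₀ σ i
  have hKD : (K - (b : ℂ) • D).IsHermitian := hK.sub (hD.ofReal_smul b)
  have hKbh : (Am ⊗ₖ (1 : Matrix m m ℂ) + (1 : Matrix m m ℂ) ⊗ₖ Ap - ∑ i, Mm i ⊗ₖ Mp i).IsHermitian := by
    rw [hKb]; exact hKD.add (isHermitian_one.ofReal_smul _)
  have hKLh : (Am ⊗ₖ (1 : Matrix m m ℂ) + (1 : Matrix m m ℂ) ⊗ₖ Am - ∑ i, Mm i ⊗ₖ Mm i).IsHermitian := by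
    rw [hKL]; exact hK.add (isHermitian_one.ofReal_smul _)
  have hKRh : (Ap ⊗ₖ (1 : Matrix m m ℂ) + (1 : Matrix m m ℂ) ⊗ₖ Ap - ∑ i, Mp i ⊗ₖ Mp i).IsHermitian := by
    rw [hKR]; exact hK.add (isHermitian_one.ofReal_smul _)
  have hRP := kls_groundEnergy_reflection Am Ap Mm Mp hAm_t hAp_t hMm_t hMp_t hKbh hKLh hKRh
  rw [hKb, hKL, hKR, liebSchupp_groundEnergy_add_real_smul_one hK,
    liebSchupp_groundEnergy_add_real_smul_one hKD] at hRP
  have hσ2 : σ ^ 2 = b ^ 2 / 4 := by rw [hσ]; ring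
  linarith

/-- The expectation of a Hermitian operator is real: `star ⟨ψ, Dψ⟩ = ⟨ψ, Dψ⟩`. [folklore] -/
private theorem liebSchupp_star_expect_eq {N : Type*} [Fintype N] {D : Matrix N N ℂ}
    (hD : D.IsHermitian) (ψ : N → ℂ) : star (star ψ ⬝ᵥ (D *ᵥ ψ)) = star ψ ⬝ᵥ (D *ᵥ ψ) := by
  rw [← star_dotProduct, star_mulVec, hD.eq, ← dotProduct_mulVec]

/-- **The ice rule** ([LiebSchupp2000] §7, eq. (ice); [LiebSchupp1999] p. 3): under the hypotheses
of `liebSchupp_groundEnergy_sub_field_ge`, EVERY ground-state vector `ψ` of `K` satisfies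
`⟨ψ, (M ⊗ 1 - 1 ⊗ M) ψ⟩ = 0` — "The expectation of the third spin component of the sites involved in
each crossing bond `B`, weighted by their coefficients `jᵢ`, vanishes for any ground state `ψ₀`"
(in the rotated frame the physical `S³_B + S³_{B'}` is `M ⊗ 1 - 1 ⊗ M`). Variational argument as
printed: `⟨ψ₀|H(b)|ψ₀⟩ ≥ E_b ≥ E_0`, i.e. `b⟨ψ₀|D|ψ₀⟩ ≤ b²‖ψ₀‖²/2` for all real `b`; take
`b = ⟨D⟩/‖ψ₀‖²`. [cite: LiebSchupp2000, §7] [cite: LiebSchupp1999, p. 3] -/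
theorem liebSchupp_iceRule [Nonempty m] {ι : Type*} [Fintype ι] [DecidableEq ι]
    (A : Matrix m m ℂ) (M : ι → Matrix m m ℂ) (hA : Aᵀ = A) (hMt : ∀ i, (M i)ᵀ = (M i)ᴴ)
    (i₀ : ι) (hMs : (M i₀)ᵀ = M i₀)
    (hK : (A ⊗ₖ (1 : Matrix m m ℂ) + (1 : Matrix m m ℂ) ⊗ₖ A - ∑ i, M i ⊗ₖ M i).IsHermitian)
    {ψ : m × m → ℂ}
    (hψ : ψ ∈ (A ⊗ₖ (1 : Matrix m m ℂ) + (1 : Matrix m m ℂ) ⊗ₖ A - ∑ i, M i ⊗ₖ M i).groundSpace) :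
    star ψ ⬝ᵥ ((M i₀ ⊗ₖ (1 : Matrix m m ℂ) - (1 : Matrix m m ℂ) ⊗ₖ M i₀) *ᵥ ψ) = 0 := by
  set K := A ⊗ₖ (1 : Matrix m m ℂ) + (1 : Matrix m m ℂ) ⊗ₖ A - ∑ i, M i ⊗ₖ M i with hKdef
  set D := M i₀ ⊗ₖ (1 : Matrix m m ℂ) - (1 : Matrix m m ℂ) ⊗ₖ M i₀ with hDdef
  have hD : D.IsHermitian := liebSchupp_field_isHermitian (hMt i₀) hMs
  set d : ℂ := star ψ ⬝ᵥ (D *ᵥ ψ) with hd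
  set t : ℂ := star ψ ⬝ᵥ ψ with ht
  -- `d` and `t` are real, `t ≥ 0`
  have hdre : (d.re : ℂ) = d :=
    Complex.conj_eq_iff_re.1 (by simpa [hd] using liebSchupp_star_expect_eq hD ψ)
  have ht0 : (0 : ℂ) ≤ t := dotProduct_star_self_nonneg ψ
  obtain ⟨htre, htim⟩ := Complex.nonneg_iff.mp ht0
  have htre' : (t.re : ℂ) = t := Complex.ext (by simp) (by simp [← htim])
  have hKψ : K *ᵥ ψ = (K.groundEnergy : ℂ) • ψ := (mem_groundSpace_iff K ψ).1 hψ
  -- the variational inequality `b·d ≤ (b²/2)·t` for every real `b`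
  have key : ∀ b : ℝ, b * d.re ≤ b ^ 2 / 2 * t.re := by
    intro b
    have hKD : (K - (b : ℂ) • D).IsHermitian := hK.sub (hD.ofReal_smul b)
    have hEb := liebSchupp_groundEnergy_sub_field_ge A M hA hMt i₀ hMs hK b
    rw [← hKdef, ← hDdef] at hEb
    have h0 := (posSemidef_sub_groundEnergy hKD).dotProduct_mulVec_nonneg ψ
    simp only [sub_mulVec, Algebra.algebraMap_eq_smul_one, smul_mulVec, one_mulVec, hKψ,
      dotProduct_sub, dotProduct_smul, smul_eq_mul, Complex.real_smul] at h0
    rw [← ht, ← hd, ← hdre, ← htre'] at h0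
    obtain ⟨hre, -⟩ := Complex.nonneg_iff.mp h0
    simp only [Complex.sub_re, Complex.mul_re, Complex.ofReal_re, Complex.ofReal_im, mul_zero,
      sub_zero] at hre
    nlinarith [mul_nonneg (sub_nonneg.2 hEb) htre, hre]
  -- conclude `d.re = 0`
  have hdre0 : d.re = 0 := by
    rcases eq_or_lt_of_le htre with ht0' | htpos
    · -- `t = 0`: then `ψ = 0`
      have hψ0 : ψ = 0 := by
        apply dotProduct_star_self_eq_zero.1
        rw [← ht, ← htre', ← ht0', Complex.ofReal_zero]
      simp [hd, hψ0]
    · have h := key (d.re / t.re)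
      have h' : d.re ^ 2 / t.re ≤ d.re ^ 2 / t.re / 2 := by
        have e1 : d.re / t.re * d.re = d.re ^ 2 / t.re := by ring
        have e2 : (d.re / t.re) ^ 2 / 2 * t.re = d.re ^ 2 / t.re / 2 := by
          field_simp
        rw [e1, e2] at h
        exact h
      have hnn : 0 ≤ d.re ^ 2 / t.re := div_nonneg (sq_nonneg _) htpos.le
      have hsq : d.re ^ 2 / t.re = 0 := by linarith
      rw [div_eq_zero_iff] at hsq
      rcases hsq with hsq | hsq
      · exact pow_eq_zero_iff (n := 2) (by norm_num) |>.1 hsq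
      · exact absurd hsq htpos.ne'
  rw [← hdre, hdre0, Complex.ofReal_zero]

/-! ### The thermal version `Z_b ≤ Z_0` ([LiebSchupp1999] p. 4) -/

omit [Fintype m] in
/-- `-β·(X ⊗ 1 + 1 ⊗ Y - Σᵢ Pᵢ ⊗ Qᵢ) = (-βX) ⊗ 1 + 1 ⊗ (-βY) + Σᵢ (√β Pᵢ) ⊗ (√β Qᵢ)` for `β ≥ 0`
(the form to which DLS Lemma 4.1, `Matrix.trace_exp_kroneckerSum_le`, applies). [folklore] -/
private theorem liebSchupp_neg_smul_kroneckerForm {ι : Type*} [Fintype ι] {β : ℝ} (hβ : 0 ≤ β)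
    (X Y : Matrix m m ℂ) (P Q : ι → Matrix m m ℂ) :
    -(β : ℂ) • (X ⊗ₖ (1 : Matrix m m ℂ) + (1 : Matrix m m ℂ) ⊗ₖ Y - ∑ i, P i ⊗ₖ Q i) =
      (-(β : ℂ) • X) ⊗ₖ (1 : Matrix m m ℂ) + (1 : Matrix m m ℂ) ⊗ₖ (-(β : ℂ) • Y) +
        ∑ i, ((Real.sqrt β : ℂ) • P i) ⊗ₖ ((Real.sqrt β : ℂ) • Q i) := by
  have hsq : (Real.sqrt β : ℂ) * Real.sqrt β = β := by
    rw [← Complex.ofReal_mul, Real.mul_self_sqrt hβ]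
  simp only [smul_sub, smul_add, smul_kronecker, kronecker_smul, Finset.smul_sum, smul_smul, hsq]
  rw [sub_eq_add_neg, ← Finset.sum_neg_distrib]
  congr 1
  refine sum_congr rfl fun i _ => ?_
  rw [neg_smul, neg_neg]

/-- **`Z_b ≤ Z_0` at positive temperature** ([LiebSchupp1999] p. 4: "All these results continue to
hold at finite temperature. The analog of [`E_b ≥ E_0`] holds also for the partition function … as
can be shown by a straightforward application of lemma 4.1 in section 4 of [DLS]"): for the
reflection-symmetric Kronecker Hamiltonian `K = A ⊗ 1 + 1 ⊗ A - Σᵢ Mᵢ ⊗ Mᵢ` with `A` and the `Mᵢ`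
REAL and `K` Hermitian, a distinguished real symmetric `M = M_{i₀}`, `β ≥ 0` and every real `b`,
`Z_β(K - b(M ⊗ 1 - 1 ⊗ M)) ≤ e^{βb²/2} Z_β(K)` (`M = M_{i₀}`), i.e. with `H(b) = H - bD + b²/2`:
`Z_β(H(b)) ≤ Z_β(H)`, `F(b) + b²/2 ≥ F(0)`. Proof: DLS Lemma 4.1 (`Matrix.trace_exp_kroneckerSum_le`)
for the data `A ∓ (b/2)M`, `M ∓ b/2` of `liebSchupp_kroneckerForm_update_eq`, both of whose doubled
Hamiltonians are `K - b²/4`. [cite: LiebSchupp1999, p. 4] [cite: DLS1978, Lemma 4.1] -/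
theorem liebSchupp_partitionFn_sub_field_le [Nonempty m] {ι : Type*} [Fintype ι] [DecidableEq ι]
    (A : Matrix m m ℂ) (M : ι → Matrix m m ℂ) (hAr : Aᵀ = Aᴴ) (hMt : ∀ i, (M i)ᵀ = (M i)ᴴ)
    (i₀ : ι) (hMs : (M i₀)ᵀ = M i₀)
    (hK : (A ⊗ₖ (1 : Matrix m m ℂ) + (1 : Matrix m m ℂ) ⊗ₖ A - ∑ i, M i ⊗ₖ M i).IsHermitian)
    {β : ℝ} (hβ : 0 ≤ β) (b : ℝ) :
    (partitionFn β ((A ⊗ₖ (1 : Matrix m m ℂ) + (1 : Matrix m m ℂ) ⊗ₖ A - ∑ i, M i ⊗ₖ M i) -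
        (b : ℂ) • (M i₀ ⊗ₖ (1 : Matrix m m ℂ) - (1 : Matrix m m ℂ) ⊗ₖ M i₀))).re ≤
      Real.exp (β * b ^ 2 / 2) *
        (partitionFn β (A ⊗ₖ (1 : Matrix m m ℂ) + (1 : Matrix m m ℂ) ⊗ₖ A - ∑ i, M i ⊗ₖ M i)).re := by
  set K := A ⊗ₖ (1 : Matrix m m ℂ) + (1 : Matrix m m ℂ) ⊗ₖ A - ∑ i, M i ⊗ₖ M i with hKdef
  set D := M i₀ ⊗ₖ (1 : Matrix m m ℂ) - (1 : Matrix m m ℂ) ⊗ₖ M i₀ with hDdef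
  set σ : ℝ := b / 2 with hσ
  set Am : Matrix m m ℂ := A + ((-σ : ℝ) : ℂ) • M i₀ with hAm
  set Ap : Matrix m m ℂ := A + (σ : ℂ) • M i₀ with hAp
  set Mm : ι → Matrix m m ℂ := Function.update M i₀ (M i₀ + ((-σ : ℝ) : ℂ) • (1 : Matrix m m ℂ))
    with hMm
  set Mp : ι → Matrix m m ℂ := Function.update M i₀ (M i₀ + (σ : ℂ) • (1 : Matrix m m ℂ)) with hMp
  -- the three Kronecker forms (as in `liebSchupp_groundEnergy_sub_field_ge`)
  have hKb : Am ⊗ₖ (1 : Matrix m m ℂ) + (1 : Matrix m m ℂ) ⊗ₖ Ap - ∑ i, Mm i ⊗ₖ Mp i =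
      (K - (b : ℂ) • D) + ((σ ^ 2 : ℝ) : ℂ) • (1 : Matrix (m × m) (m × m) ℂ) := by
    rw [hAm, hAp, hMm, hMp, liebSchupp_kroneckerForm_update_eq, ← hKdef, ← hDdef]
    have h1 : ((-σ : ℝ) : ℂ) - (σ : ℂ) = -(b : ℂ) := by
      rw [hσ]; push_cast; ring
    have h2 : ((-σ : ℝ) : ℂ) * (σ : ℂ) = -((σ ^ 2 : ℝ) : ℂ) := by push_cast; ring
    rw [h1, h2, neg_smul, neg_smul, sub_neg_eq_add, ← sub_eq_add_neg]
  have hKL : Am ⊗ₖ (1 : Matrix m m ℂ) + (1 : Matrix m m ℂ) ⊗ₖ Am - ∑ i, Mm i ⊗ₖ Mm i =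
      K + ((-(σ ^ 2) : ℝ) : ℂ) • (1 : Matrix (m × m) (m × m) ℂ) := by
    rw [hAm, hMm, liebSchupp_kroneckerForm_update_eq, ← hKdef, sub_self, zero_smul, add_zero]
    have h2 : ((-σ : ℝ) : ℂ) * ((-σ : ℝ) : ℂ) = -((-(σ ^ 2) : ℝ) : ℂ) := by push_cast; ring
    rw [h2, neg_smul, sub_neg_eq_add]
  have hKR : Ap ⊗ₖ (1 : Matrix m m ℂ) + (1 : Matrix m m ℂ) ⊗ₖ Ap - ∑ i, Mp i ⊗ₖ Mp i =
      K + ((-(σ ^ 2) : ℝ) : ℂ) • (1 : Matrix (m × m) (m × m) ℂ) := by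
    rw [hAp, hMp, liebSchupp_kroneckerForm_update_eq, ← hKdef, sub_self, zero_smul, add_zero]
    have h2 : (σ : ℂ) * (σ : ℂ) = -((-(σ ^ 2) : ℝ) : ℂ) := by push_cast; ring
    rw [h2, neg_smul, sub_neg_eq_add]
  -- realness of the data
  have hAm_r : Amᵀ = Amᴴ := by
    rw [hAm]; exact transpose_eq_conjTranspose_add hAr (transpose_eq_conjTranspose_ofReal_smul (hMt i₀) _)
  have hAp_r : Apᵀ = Apᴴ := by
    rw [hAp]; exact transpose_eq_conjTranspose_add hAr (transpose_eq_conjTranspose_ofReal_smul (hMt i₀) _)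
  have hMm_t : ∀ i, (Mm i)ᵀ = (Mm i)ᴴ := fun i => liebSchupp_update_transpose_eq hMt i₀ (-σ) i
  have hMp_t : ∀ i, (Mp i)ᵀ = (Mp i)ᴴ := fun i => liebSchupp_update_transpose_eq hMt i₀ σ i
  have hnegβ : ∀ {X : Matrix m m ℂ}, Xᵀ = Xᴴ → (-(β : ℂ) • X)ᵀ = (-(β : ℂ) • X)ᴴ := by
    intro X hX
    have h := transpose_eq_conjTranspose_ofReal_smul hX (-β)
    rwa [Complex.ofReal_neg] at h
  have hsM : ∀ {P : ι → Matrix m m ℂ}, (∀ i, (P i)ᵀ = (P i)ᴴ) →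
      ∀ i, ((Real.sqrt β : ℂ) • P i)ᵀ = ((Real.sqrt β : ℂ) • P i)ᴴ := fun hP i =>
    transpose_eq_conjTranspose_ofReal_smul (hP i) _
  -- partition functions as traces of exponentials of the DLS forms
  have hZ : ∀ (X Y : Matrix m m ℂ) (P Q : ι → Matrix m m ℂ),
      partitionFn β (X ⊗ₖ (1 : Matrix m m ℂ) + (1 : Matrix m m ℂ) ⊗ₖ Y - ∑ i, P i ⊗ₖ Q i) =
        (NormedSpace.exp ((-(β : ℂ) • X) ⊗ₖ (1 : Matrix m m ℂ) +
          (1 : Matrix m m ℂ) ⊗ₖ (-(β : ℂ) • Y) +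
          ∑ i, ((Real.sqrt β : ℂ) • P i) ⊗ₖ ((Real.sqrt β : ℂ) • Q i))).trace := by
    intro X Y P Q
    rw [partitionFn, gibbsWeight, liebSchupp_neg_smul_kroneckerForm hβ]
  have hDLS := Matrix.trace_exp_kroneckerSum_le (m := m) (n := m) (hnegβ hAm_r) (hnegβ hAp_r)
    (hsM hMm_t) (hsM hMp_t)
  rw [← hZ, ← hZ, ← hZ, hKb, hKL, hKR, partitionFn_add_smul_one, partitionFn_add_smul_one,
    Complex.re_ofReal_mul, Complex.re_ofReal_mul] at hDLS
  -- positivity and bookkeeping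
  have hKD : (K - (b : ℂ) • D).IsHermitian :=
    hK.sub ((liebSchupp_field_isHermitian (hMt i₀) hMs).ofReal_smul b)
  have hZK : 0 < (partitionFn β K).re :=
    Literature.MathematicalPhysics.QuantumLattice.partitionFn_re_pos hK β
  have hZKD : 0 < (partitionFn β (K - (b : ℂ) • D)).re :=
    Literature.MathematicalPhysics.QuantumLattice.partitionFn_re_pos hKD β
  have hx : 0 ≤ Real.exp (-(β * -(σ ^ 2))) * (partitionFn β K).re :=
    mul_nonneg (Real.exp_pos _).le hZK.le
  rw [← Real.sqrt_mul_self hx] at hDLS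
  rw [Real.sqrt_mul_self hx] at hDLS
  have hmain : Real.exp (-(β * σ ^ 2)) * (partitionFn β (K - (b : ℂ) • D)).re ≤
      Real.exp (β * σ ^ 2) * (partitionFn β K).re := by
    have e1 : -(β * -(σ ^ 2)) = β * σ ^ 2 := by ring
    rw [e1] at hDLS
    calc Real.exp (-(β * σ ^ 2)) * (partitionFn β (K - (b : ℂ) • D)).re
        ≤ Real.sqrt (Real.exp (β * σ ^ 2) * (partitionFn β K).re) *
          Real.sqrt (Real.exp (β * σ ^ 2) * (partitionFn β K).re) := hDLS
      _ = Real.exp (β * σ ^ 2) * (partitionFn β K).re :=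
          Real.mul_self_sqrt (mul_nonneg (Real.exp_pos _).le hZK.le)
  have hexp : Real.exp (β * b ^ 2 / 2) = Real.exp (β * σ ^ 2) * Real.exp (β * σ ^ 2) := by
    rw [← Real.exp_add]; congr 1; rw [hσ]; ring
  have hpos : 0 < Real.exp (-(β * σ ^ 2)) := Real.exp_pos _
  have hinv : Real.exp (β * σ ^ 2) * Real.exp (-(β * σ ^ 2)) = 1 := by
    rw [← Real.exp_add, add_neg_cancel, Real.exp_zero]
  calc (partitionFn β (K - (b : ℂ) • D)).re
      = Real.exp (β * σ ^ 2) * (Real.exp (-(β * σ ^ 2)) * (partitionFn β (K - (b : ℂ) • D)).re) := by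
        rw [← mul_assoc, hinv, one_mul]
    _ ≤ Real.exp (β * σ ^ 2) * (Real.exp (β * σ ^ 2) * (partitionFn β K).re) :=
        mul_le_mul_of_nonneg_left hmain (Real.exp_pos _).le
    _ = Real.exp (β * b ^ 2 / 2) * (partitionFn β K).re := by rw [hexp, mul_assoc]

/-! ### A ground state annihilated by all rotated charges ([LiebSchupp2000] §5) -/

/-- **"There is always a ground state with total spin zero"** ([LiebSchupp2000] §5, last
paragraph; [LiebSchupp1999] p. 3), abstract Kronecker form: let `K = A ⊗ 1 + 1 ⊗ A - Σᵢ Mᵢ ⊗ Mᵢ`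
(`Aᵀ = A`, `Mᵢ` real, `K` Hermitian) and let charges `Q_j = X_j ⊗ 1 + 1 ⊗ Y_j` with `Y_jᵀ = -X_j`
commute with `K` ("provided that total spin is a good quantum number"). Then `K` has a non-zero
ground-state vector annihilated by every `Q_j`: the ground-state projection of the canonical state
`vec 1`, which is non-zero because the positive ground state `vec c` of
`Matrix.exists_posSemidef_groundState` has `⟨vec 1, vec c⟩ = tr c > 0`.
[cite: LiebSchupp2000, §5] [cite: LiebSchupp1999, p. 3] -/
theorem liebSchupp_exists_groundState_annihilated [Nonempty m] {ι κ : Type*} [Fintype ι]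
    (A : Matrix m m ℂ) (M : ι → Matrix m m ℂ) (hA : Aᵀ = A) (hMt : ∀ i, (M i)ᵀ = (M i)ᴴ)
    (hK : (A ⊗ₖ (1 : Matrix m m ℂ) + (1 : Matrix m m ℂ) ⊗ₖ A - ∑ i, M i ⊗ₖ M i).IsHermitian)
    (X Y : κ → Matrix m m ℂ) (hXY : ∀ j, (Y j)ᵀ = -X j)
    (hcomm : ∀ j, (X j ⊗ₖ (1 : Matrix m m ℂ) + (1 : Matrix m m ℂ) ⊗ₖ Y j) *
        (A ⊗ₖ (1 : Matrix m m ℂ) + (1 : Matrix m m ℂ) ⊗ₖ A - ∑ i, M i ⊗ₖ M i) =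
      (A ⊗ₖ (1 : Matrix m m ℂ) + (1 : Matrix m m ℂ) ⊗ₖ A - ∑ i, M i ⊗ₖ M i) *
        (X j ⊗ₖ (1 : Matrix m m ℂ) + (1 : Matrix m m ℂ) ⊗ₖ Y j)) :
    ∃ φ ∈ (A ⊗ₖ (1 : Matrix m m ℂ) + (1 : Matrix m m ℂ) ⊗ₖ A - ∑ i, M i ⊗ₖ M i).groundSpace,
      φ ≠ 0 ∧ ∀ j, (X j ⊗ₖ (1 : Matrix m m ℂ) + (1 : Matrix m m ℂ) ⊗ₖ Y j) *ᵥ φ = 0 := by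
  obtain ⟨c, -, -, hmem, -, hov⟩ := liebSchupp_exists_posSemidef_groundState_trace_pos A M hA hMt hK
  have hov' : star (fun p : m × m => c p.1 p.2) ⬝ᵥ (fun p : m × m => (1 : Matrix m m ℂ) p.1 p.2) ≠ 0 := by
    rw [star_dotProduct]
    exact star_ne_zero.2 hov
  obtain ⟨φ, hφ, -, hφ0, hQ⟩ := exists_groundState_forall_mulVec_eq_zero hK
    (fun j => X j ⊗ₖ (1 : Matrix m m ℂ) + (1 : Matrix m m ℂ) ⊗ₖ Y j) hcomm
    (fun j => kroneckerSum_mulVec_uncurry_one_eq_zero (hXY j)) hmem hov'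
  exact ⟨φ, hφ, hφ0, hQ⟩

end Field

end Matrix
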